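import Literature.Probability.Percolation.FoldingFibresFourFunctions
import HarnessLib
import HarnessLib.Audit

/-!
# `NoHeavyLowerTail` (crux stmt-CriticalPhenomena-4575), route P3 (Ahlswede–Daykin / four functions):
# the THREE-PARTITION form of Sahi's `C₃` and what the two-function AD family proves of it

Support file (cell `prim-l12`, seat P3 = "cast `L1 ≥ 0` / Sahi `C₃` as an Ahlswede–Daykin instance";
`--supports stmt-CriticalPhenomena-4575`).  Nothing here is asserted about the crux; the one open statement
is the `@[conjecture]`-tagged `ThreePartitionPositivity` (our conjecture, census below), everything else is proved.

## The statement

For a finite ground set `ι` and three up-sets `𝒰, 𝒱, 𝒲 ⊆ 𝒫(ι)` count ORDERED 3-PARTITIONS `(S₁,S₂,S₃)` of `ι`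
(encoded as disjoint pairs `(S₁,S₂)`, `S₃ = (S₁ ∪ S₂)ᶜ`):
* `top 𝒞`      = `#{(S₁,S₂,S₃) : S₃ ∈ 𝒞}`                       (one part carries everything),
* `dee 𝒜 ℬ`    = `#{(S₁,S₂,S₃) : S₁ ∈ 𝒜, S₃ ∈ ℬ}`               (requirements split 1 + 2),
* `tee 𝒰 𝒱 𝒲` = `#{(S₁,S₂,S₃) : S₁ ∈ 𝒰, S₂ ∈ 𝒱, S₃ ∈ 𝒲}`        (split 1 + 1 + 1),
and put `N(𝒰,𝒱,𝒲) := 2·top(𝒰∩𝒱∩𝒲) + tee(𝒰,𝒱,𝒲) − dee(𝒰,𝒱∩𝒲) − dee(𝒱,𝒰∩𝒲) − dee(𝒲,𝒰∩𝒱)` (`threePartN`).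

**`ThreePartitionPositivity`** (this work, CONJECTURE): `N(𝒰,𝒱,𝒲) ≥ 0` for all finite `ι` and all up-sets.

Why this is the right object for the AD route.  `6·N(𝒰,𝒱,𝒲)` is the three-copy FIBRE SUM of the Richards–Sahi kernel
(`…ThreeCopyFibre.richardsKernel`, `Z = perm − A + 4r` on the `3×3` incidence matrix of the partition against
`(𝒰,𝒱,𝒲)`) on the all-active profile; every other profile of every up-set triple of a cube `{0,1}^E` reduces to an
instance of the TWISTED functional `threePartNT τ` of the companion file `…ThreePartitionADTwisted` (`τ` = the active coordinates
open in exactly two copies; copy `a` = `S_a ∆ τ`), so `ThreePartitionPositivityTwisted` is EQUIVALENT to the cell's comb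
statement COMB-C3 ("every fibre sum of `E₃` is `≥ 0`") and `ThreePartitionPositivity` (= the slice `τ = ∅`) is implied by it;
COMB-C3 implies Sahi's `C₃` / Kahn's Conjecture 5 for every product measure by `…ThreeCopyFibre.e3_nonneg_of_fibres` (the
formal bridge `N ↔ fibsum richardsKernel` is not in this file; it was checked by machine, seat folder `lab/fib3.c`, `lab/fib3t.c`).  Census (exact): all up-set triples of `2^[m]`, `m ≤ 4` — `10 / 56 / 1 540 / 804 440`
unordered triples, `0` negative, minimum `0` (this seat, `lab/fib3.c`, reproducing prim-ineq-gen-4's count `804 440` and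
ttrl2's `rcomb` census `k ≤ 5`, `1.93·10¹¹` fibre sums, `0` negative).

## What the two-function Ahlswede–Daykin family gives (PROVED here) and what it cannot give

The merge chain `tee ≤ dee ≤ top` ("concentrating the three requirements on fewer parts can only increase the count")
is the four functions theorem applied on the sub-cube `2^{ι ∖ S}` of the spectator part `S`, i.e. the tree's fibrewise
four-EVENTS theorem `FoldingFibre.fibreCount_le_of_fourEvents` (Aharoni–Keich Prop. 4.4 / Christofides Thm 2.2 /
Chan–Pak Claim 6.3): `tee_le_dee`, `dee_le_top`.  Hence `N ≥ 0` is the CONVEXITY statement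
`2·Σᵢ (top − deeᵢ) ≥ Σᵢ (deeᵢ − tee)` along that chain (`threePartN_eq_convexity`), and it holds outright when one
family is trivial (`threePartN_univ_nonneg`: `N(⊤,𝒱,𝒲) = top(𝒱∩𝒲) − dee(𝒲,𝒱) ≥ 0`, the fibre form of Sahi's branching
`E₃(1,g,h) = E₂(g,h)` = "Kleitman twice") and on the diagonal (`threePartN_diag_nonneg`).

NO-GO (this work, exact certificates in the seat folder, memo `run/shared/lean/prim/prim-l12/prim-l12-p3/MEMO-P3-AD.md`):
(a) FIBRE level — at the granularity of the `8³` incidence TYPES of a partition (which part lies in which of `𝒰,𝒱,𝒲`),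
the cone generated by ALL `0/1` event-measurable instances of the fibrewise four functions theorem WITH SPECTATOR (the proved
`k = 2` layer, `1 200 × 8` maximal rows) together with ALL `0/1` event-measurable instances of the level-wise three-function
conjecture of Aharoni–Keich (1996, Conj. 4.3, `n = 3`; `3 042` maximal rows; OPEN in print) does not contain `N`: an exact
pseudo-count on `17` type orbits gives the value `−16/39` while satisfying every such row (row generation converged: no
violated row in either family).  (b) MEASURE level — the `8`-cell vector `m = (233/1140; 17/285 ×3; 3/20 ×3; 1/6)` satisfies
every maximal `0/1` event-measurable instance of the four functions theorem AND of the (proved) Rinott–Saks / Aharoni–Keich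
six-function theorem (`4 242` rows; plus `2·10⁴` random real-valued instances) while `E₃(m) = −859/41154 < 0`; it is cut by the
Gladkov–Zimin quadratic cone (value `−13/900`) and is not log-supermodular on the cube of cells.  So no Ahlswede–Daykin /
`2k`-function argument whose functions are measurable with respect to the three events proves `C₃`, even granting the open
level-wise conjecture; the located gap is "realizable but not log-supermodular cell vectors" (on log-supermodular cell vectors
`E₃ ≥ 0` is the tree's `SahiC3Cube.latticeE3fun_nonneg_cube_three`).
-/

noncomputable section

open Finset
open scoped symmDiff Classical

namespace Summit.CriticalPhenomena.PercolationContinuityZ3.Theorems.ThreePartition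

open Literature.Probability.Percolation

variable {ι : Type*} [Fintype ι]

/-! ## Ordered 3-partitions and the three counts -/

/-- Number of ordered 3-partitions `(S₁,S₂,S₃)` of `ι` (encoded as disjoint pairs `(S₁,S₂)`, `S₃ = (S₁ ∪ S₂)ᶜ`)
satisfying `p S₁ S₂ S₃`. [this work] -/
def tri (p : Set ι → Set ι → Set ι → Prop) : ℕ :=
  (Finset.univ.filter fun q : Set ι × Set ι => Disjoint q.1 q.2 ∧ p q.1 q.2 (q.1 ∪ q.2)ᶜ).card

/-- `top 𝒞 = #{(S₁,S₂,S₃) : S₃ ∈ 𝒞}`: one part carries all the requirements. [this work] -/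
def top (𝒞 : Set (Set ι)) : ℕ := tri fun _ _ S₃ => S₃ ∈ 𝒞

/-- `dee 𝒜 ℬ = #{(S₁,S₂,S₃) : S₁ ∈ 𝒜, S₃ ∈ ℬ}`: requirements split `1 + 2` over two different parts
(= the number of DISJOINT pairs `(A,B)`, `A ∈ 𝒜`, `B ∈ ℬ`). [this work] -/
def dee (𝒜 ℬ : Set (Set ι)) : ℕ := tri fun S₁ _ S₃ => S₁ ∈ 𝒜 ∧ S₃ ∈ ℬ

/-- `tee 𝒰 𝒱 𝒲 = #{(S₁,S₂,S₃) : S₁ ∈ 𝒰, S₂ ∈ 𝒱, S₃ ∈ 𝒲}`: one requirement per part. [this work] -/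
def tee (𝒰 𝒱 𝒲 : Set (Set ι)) : ℕ := tri fun S₁ S₂ S₃ => S₁ ∈ 𝒰 ∧ S₂ ∈ 𝒱 ∧ S₃ ∈ 𝒲

/-- The three-partition functional `N(𝒰,𝒱,𝒲) = 2·top(𝒰∩𝒱∩𝒲) + tee(𝒰,𝒱,𝒲) − Σ_cyc dee(𝒰, 𝒱∩𝒲)`
(`= ⅙ ×` the three-copy fibre sum of the Richards–Sahi kernel on the all-active profile). [this work] -/
def threePartN (𝒰 𝒱 𝒲 : Set (Set ι)) : ℤ :=
  2 * (top (𝒰 ∩ 𝒱 ∩ 𝒲) : ℤ) + tee 𝒰 𝒱 𝒲 - (dee 𝒰 (𝒱 ∩ 𝒲) + dee 𝒱 (𝒰 ∩ 𝒲) + dee 𝒲 (𝒰 ∩ 𝒱) : ℕ)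

/-- **Three-partition positivity** (this work; OPEN): for every finite ground set and all up-sets `𝒰, 𝒱, 𝒲`,
`N(𝒰,𝒱,𝒲) ≥ 0`.  Equivalent to fibre (comb) positivity of Sahi's `E₃` for up-set triples of finite cubes, hence implies
Sahi's `C₃` / Kahn's Conjecture 5 for all product measures (`…ThreeCopyFibre.e3_nonneg_of_fibres`).  Census: exhaustive
`m ≤ 4` (`804 440` triples at `m = 4`), `0` negative; ttrl2 `k ≤ 5`, `1.93·10¹¹` fibre sums, `0` negative.  An obligation of
our theories, never a fact: use as `(h : ThreePartitionPositivity)`. [status: open] -/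
@[conjecture] def ThreePartitionPositivity : Prop :=
  ∀ (ι : Type) [Fintype ι] (𝒰 𝒱 𝒲 : Set (Set ι)),
    IsUpperSet 𝒰 → IsUpperSet 𝒱 → IsUpperSet 𝒲 → 0 ≤ threePartN 𝒰 𝒱 𝒲

/-! ## Bookkeeping: a 3-partition count as a sum over a spectator part of a folding-fibre count -/

omit [Fintype ι] in
/-- `a \ Sᶜ = ∅ ↔ Disjoint S a`. [folklore] -/
theorem diff_compl_eq_empty_iff {S a : Set ι} : a \ Sᶜ = ∅ ↔ Disjoint S a := by
  rw [Set.sdiff_compl, ← Set.disjoint_iff_inter_eq_empty, disjoint_comm]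

omit [Fintype ι] in
/-- For disjoint `S, a`: `a ∆ Sᶜ = (S ∪ a)ᶜ` (the third part). [folklore] -/
theorem symmDiff_compl_eq_of_disjoint {S a : Set ι} (h : Disjoint S a) : a ∆ Sᶜ = (S ∪ a)ᶜ := by
  ext x
  have hx : x ∈ S → x ∉ a := fun hS ha => Set.disjoint_left.1 h hS ha
  simp only [Set.mem_symmDiff, Set.mem_compl_iff, Set.mem_union, not_or]
  tauto

omit [Fintype ι] in
/-- For disjoint `S, a`: `S ∆ aᶜ = (S ∪ a)ᶜ`. [folklore] -/
theorem symmDiff_compl_eq_of_disjoint' {S a : Set ι} (h : Disjoint S a) : S ∆ aᶜ = (S ∪ a)ᶜ := by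
  rw [Set.union_comm, ← symmDiff_compl_eq_of_disjoint h.symm]

/-- Spectator = FIRST part: `tri p = Σ_{S} #{a : a \ Sᶜ = ∅ ∧ p S a (a ∆ Sᶜ)}` (the inner count is a folding-fibre count
on the cube `2^{Sᶜ}`, fibre `(M,u) = (Sᶜ, ∅)`). [this work] -/
theorem tri_eq_sum_fst (p : Set ι → Set ι → Set ι → Prop) :
    tri p = ∑ S : Set ι, (Finset.univ.filter fun a : Set ι => a \ Sᶜ = ∅ ∧ p S a (a ∆ Sᶜ)).card := by
  unfold tri
  rw [card_filter, ← univ_product_univ, sum_product]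
  refine sum_congr rfl fun S _ => ?_
  rw [card_filter]
  refine sum_congr rfl fun a _ => ?_
  by_cases h : Disjoint S a
  · have h1 : a \ Sᶜ = ∅ := diff_compl_eq_empty_iff.2 h
    simp only [h, true_and, h1, symmDiff_compl_eq_of_disjoint h]
  · have h1 : ¬ a \ Sᶜ = ∅ := fun h' => h (diff_compl_eq_empty_iff.1 h')
    simp only [h, false_and, h1, if_false]

/-- Spectator = SECOND part: `tri p = Σ_{a} #{S : S \ aᶜ = ∅ ∧ p S a (S ∆ aᶜ)}`. [this work] -/
theorem tri_eq_sum_snd (p : Set ι → Set ι → Set ι → Prop) :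
    tri p = ∑ a : Set ι, (Finset.univ.filter fun S : Set ι => S \ aᶜ = ∅ ∧ p S a (S ∆ aᶜ)).card := by
  unfold tri
  rw [card_filter, ← univ_product_univ, sum_product, sum_comm]
  refine sum_congr rfl fun a _ => ?_
  rw [card_filter]
  refine sum_congr rfl fun S _ => ?_
  by_cases h : Disjoint S a
  · have h1 : S \ aᶜ = ∅ := diff_compl_eq_empty_iff.2 h.symm
    simp only [h, true_and, h1, symmDiff_compl_eq_of_disjoint' h]
  · have h1 : ¬ S \ aᶜ = ∅ := fun h' => h (diff_compl_eq_empty_iff.1 h').symm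
    simp only [h, false_and, h1, if_false]

/-! ## The merge chain `tee ≤ dee ≤ top` (four functions theorem on the spectator's sub-cube) -/

/-- **`tee(𝒰,𝒱,𝒲) ≤ dee(𝒰, 𝒱∩𝒲)`** for up-sets `𝒱, 𝒲`: merging the requirements of parts 2 and 3 can only
increase the count (spectator `S₁`; Kleitman twice on `2^{S₁ᶜ}`). [this work] -/
theorem tee_le_dee (𝒰 : Set (Set ι)) {𝒱 𝒲 : Set (Set ι)} (h𝒱 : IsUpperSet 𝒱) (h𝒲 : IsUpperSet 𝒲) :
    tee 𝒰 𝒱 𝒲 ≤ dee 𝒰 (𝒱 ∩ 𝒲) := by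
  unfold tee dee
  rw [tri_eq_sum_fst, tri_eq_sum_fst]
  refine sum_le_sum fun S _ => ?_
  by_cases hS : S ∈ 𝒰
  · have hyp : ∀ a ∈ 𝒱, ∀ b ∈ 𝒲, a ∩ b ∈ (Set.univ : Set (Set ι)) ∧ a ∪ b ∈ 𝒱 ∩ 𝒲 :=
      fun a ha b hb => ⟨Set.mem_univ _, h𝒱 Set.subset_union_left ha, h𝒲 Set.subset_union_right hb⟩
    have hf := FoldingFibre.fibreCount_le_of_fourEvents hyp Sᶜ ∅
    refine le_trans (le_trans (card_le_card fun a ha => ?_) hf) (card_le_card fun a ha => ?_)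
    · simp only [mem_filter, mem_univ, true_and] at ha ⊢
      exact ⟨ha.1, ha.2.2.1, ha.2.2.2⟩
    · simp only [mem_filter, mem_univ, Set.mem_univ, true_and] at ha ⊢
      exact ⟨ha.1, hS, ha.2⟩
  · refine card_le_card fun a ha => ?_
    simp only [mem_filter, mem_univ, true_and] at ha
    exact absurd ha.2.1 hS

/-- **`dee(𝒜, ℬ) ≤ top(𝒜 ∩ ℬ)`** for up-sets `𝒜, ℬ`: merging the last two requirement groups can only increase the
count (spectator `S₂`; Kleitman twice on `2^{S₂ᶜ}`). [this work] -/
theorem dee_le_top {𝒜 ℬ : Set (Set ι)} (h𝒜 : IsUpperSet 𝒜) (hℬ : IsUpperSet ℬ) :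
    dee 𝒜 ℬ ≤ top (𝒜 ∩ ℬ) := by
  unfold dee top
  rw [tri_eq_sum_snd, tri_eq_sum_snd]
  refine sum_le_sum fun a _ => ?_
  have hyp : ∀ s ∈ 𝒜, ∀ b ∈ ℬ, s ∩ b ∈ (Set.univ : Set (Set ι)) ∧ s ∪ b ∈ 𝒜 ∩ ℬ :=
    fun s hs b hb => ⟨Set.mem_univ _, h𝒜 Set.subset_union_left hs, hℬ Set.subset_union_right hb⟩
  have hf := FoldingFibre.fibreCount_le_of_fourEvents hyp aᶜ ∅
  refine le_trans (le_trans (card_le_card fun S hS => ?_) hf) (card_le_card fun S hS => ?_)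
  · simp only [mem_filter, mem_univ, true_and] at hS ⊢
    exact hS
  · simp only [mem_filter, mem_univ, Set.mem_univ, true_and] at hS ⊢
    exact hS

/-- The full merge chain for three up-sets: `tee(𝒰,𝒱,𝒲) ≤ dee(𝒰,𝒱∩𝒲) ≤ top(𝒰∩𝒱∩𝒲)`. [this work] -/
theorem tee_le_dee_le_top {𝒰 𝒱 𝒲 : Set (Set ι)} (h𝒰 : IsUpperSet 𝒰) (h𝒱 : IsUpperSet 𝒱) (h𝒲 : IsUpperSet 𝒲) :
    tee 𝒰 𝒱 𝒲 ≤ dee 𝒰 (𝒱 ∩ 𝒲) ∧ dee 𝒰 (𝒱 ∩ 𝒲) ≤ top (𝒰 ∩ 𝒱 ∩ 𝒲) := by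
  refine ⟨tee_le_dee 𝒰 h𝒱 h𝒲, ?_⟩
  have h := dee_le_top h𝒰 (h𝒱.inter h𝒲)
  rwa [← Set.inter_assoc] at h

/-! ## `N ≥ 0` as convexity along the merge chain; the cases the two-function family settles -/

/-- `N(𝒰,𝒱,𝒲) ≥ 0` **is the convexity inequality** `2·Σᵢ (top − deeᵢ) ≥ Σᵢ (deeᵢ − tee)` along the merge chain
(each bracket is `≥ 0` by `tee_le_dee` / `dee_le_top` and the symmetry of partition counts). [this work] -/
theorem threePartN_eq_convexity (𝒰 𝒱 𝒲 : Set (Set ι)) :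
    3 * threePartN 𝒰 𝒱 𝒲 =
      2 * ((top (𝒰 ∩ 𝒱 ∩ 𝒲) - dee 𝒰 (𝒱 ∩ 𝒲) : ℤ) + (top (𝒰 ∩ 𝒱 ∩ 𝒲) - dee 𝒱 (𝒰 ∩ 𝒲) : ℤ)
          + (top (𝒰 ∩ 𝒱 ∩ 𝒲) - dee 𝒲 (𝒰 ∩ 𝒱) : ℤ))
      - ((dee 𝒰 (𝒱 ∩ 𝒲) - tee 𝒰 𝒱 𝒲 : ℤ) + (dee 𝒱 (𝒰 ∩ 𝒲) - tee 𝒰 𝒱 𝒲 : ℤ)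
          + (dee 𝒲 (𝒰 ∩ 𝒱) - tee 𝒰 𝒱 𝒲 : ℤ)) := by
  unfold threePartN
  push_cast
  ring

/-- `dee(⊤, ℬ) = top ℬ`. [this work] -/
theorem dee_univ (ℬ : Set (Set ι)) : dee (Set.univ : Set (Set ι)) ℬ = top ℬ := by
  unfold dee top tri
  congr 1; ext q; simp

/-- `tee(⊤, 𝒱, 𝒲) = dee(𝒱, 𝒲)` (swap the first two parts). [this work] -/
theorem tee_univ (𝒱 𝒲 : Set (Set ι)) : tee (Set.univ : Set (Set ι)) 𝒱 𝒲 = dee 𝒱 𝒲 := by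
  unfold tee dee tri
  refine card_bij (fun q _ => (q.2, q.1)) (fun q hq => ?_) (fun q _ q' _ h => ?_) (fun q hq => ?_)
  · simp only [mem_filter, mem_univ, true_and, Set.mem_univ] at hq ⊢
    exact ⟨hq.1.symm, hq.2.1, by rw [Set.union_comm]; exact hq.2.2⟩
  · simp only [Prod.mk.injEq] at h
    exact Prod.ext h.2 h.1
  · refine ⟨(q.2, q.1), ?_, rfl⟩
    simp only [mem_filter, mem_univ, true_and, Set.mem_univ] at hq ⊢
    exact ⟨hq.1.symm, hq.2.1, by rw [Set.union_comm]; exact hq.2.2⟩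

omit [Fintype ι] in
/-- For disjoint `S₁, S₂`: `((S₁ ∪ S₂)ᶜ ∪ S₂)ᶜ = S₁` (part 1 recovered from parts 3 and 2). [folklore] -/
theorem compl_union_compl_union_eq {S₁ S₂ : Set ι} (h : Disjoint S₁ S₂) : ((S₁ ∪ S₂)ᶜ ∪ S₂)ᶜ = S₁ := by
  ext x
  have hx : x ∈ S₁ → x ∉ S₂ := fun h1 h2 => Set.disjoint_left.1 h h1 h2
  simp only [Set.compl_union, Set.mem_compl_iff, Set.mem_inter_iff]
  tauto

/-- `dee` is symmetric: `#{S₁ ∈ 𝒜, S₃ ∈ ℬ} = #{S₁ ∈ ℬ, S₃ ∈ 𝒜}` (the involution `(S₁,S₂,S₃) ↦ (S₃,S₂,S₁)`). [this work] -/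
theorem dee_comm (𝒜 ℬ : Set (Set ι)) : dee 𝒜 ℬ = dee ℬ 𝒜 := by
  unfold dee tri
  refine card_bij (fun q _ => ((q.1 ∪ q.2)ᶜ, q.2)) (fun q hq => ?_) (fun q hq q' hq' h => ?_) (fun q hq => ?_)
  · simp only [mem_filter, mem_univ, true_and] at hq ⊢
    obtain ⟨hd, h1, h3⟩ := hq
    refine ⟨Set.disjoint_left.2 fun x hx hx2 => hx (Or.inr hx2), h3, ?_⟩
    rw [compl_union_compl_union_eq hd]; exact h1
  · simp only [mem_filter, mem_univ, true_and] at hq hq'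
    simp only [Prod.mk.injEq] at h
    have e1 : q.1 = q'.1 := by
      rw [← compl_union_compl_union_eq hq.1, ← compl_union_compl_union_eq hq'.1, h.1, h.2]
    exact Prod.ext e1 h.2
  · simp only [mem_filter, mem_univ, true_and] at hq
    obtain ⟨hd, h1, h3⟩ := hq
    have hd' : Disjoint (q.1 ∪ q.2)ᶜ q.2 := Set.disjoint_left.2 fun x hx hx2 => hx (Or.inr hx2)
    refine ⟨((q.1 ∪ q.2)ᶜ, q.2), ?_, ?_⟩
    · simp only [mem_filter, mem_univ, true_and]
      refine ⟨hd', h3, ?_⟩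
      rw [compl_union_compl_union_eq hd]; exact h1
    · simp only [compl_union_compl_union_eq hd]

/-- **`N(⊤, 𝒱, 𝒲) = top(𝒱∩𝒲) − dee(𝒲,𝒱) ≥ 0`**: with one trivial family the three-partition inequality is
"Kleitman twice" (the fibre form of Sahi's branching rule `E₃(1,g,h) = E₂(g,h)`). [this work] -/
theorem threePartN_univ_nonneg {𝒱 𝒲 : Set (Set ι)} (h𝒱 : IsUpperSet 𝒱) (h𝒲 : IsUpperSet 𝒲) :
    0 ≤ threePartN (Set.univ : Set (Set ι)) 𝒱 𝒲 := by
  unfold threePartN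
  simp only [Set.univ_inter, dee_univ, tee_univ]
  have h := dee_le_top h𝒲 h𝒱
  rw [Set.inter_comm] at h
  push_cast
  omega

end Summit.CriticalPhenomena.PercolationContinuityZ3.Theorems.ThreePartition
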